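import Mathlib
import Summits.Ventures.PercRepro2.Harris
import Summits.Ventures.PercRepro2.BasePrime
import Summits.Ventures.PercRepro2.LocRows
import Summits.Ventures.PercRepro2.SwRow
import Summits.Ventures.PercRepro2.SwOut
import Summits.Ventures.PercRepro2.SwAllRow
import Summits.Ventures.PercRepro2.SwOutAll
import Summits.Ventures.PercRepro2.SwOutCube
import Summits.Ventures.PercRepro2.SwOutMixedCubeFarDefs
import Summits.Ventures.PercRepro2.SwOutBigBlockDefs
import Summits.Ventures.PercRepro2.SwOutBigBlockCube
import Summits.Ventures.PercRepro2.SwOutMixedCore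
import Summits.Ventures.PercRepro2.SwOutMixedCorePieces
import Summits.Ventures.PercRepro2.SwOutMixedCoreLower
import Summits.Ventures.PercRepro2.SwOutMixedCoreThm

/-!
# The corrected big-block principle, edge-set form (blind cell PercRepro2, night-4 g18, 2026-08-27;
proofs/NIGHT4-G18.md §1–§3)

The interface between the corrected abstract big-block lemma `mixedCore_card_le` (the block is
three cubes; `SwOutMixedCoreThm`) and a class of configurations: a block `C` of configurations that
is the injective image of the NON-LEAKING points (`¬ Leak'`, the corrected leak set with the
dead-edge leaks) of the raw cube `Pt ι κ` under a realisation `r`, on which the red edge set of `h`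
is the image of the abstract red set `ER` under a monotone map `φ` of atom sets to edge sets (and
the blue edge set the image of `EB`), and whose conditioning pulls back to a BLOCK-LOWER set (lower
between non-leaking points only) with `G5` (the X-move at a dropped `P`), satisfies the rigid counting inequality on `C ∩ Qs` for every up-set
`𝓔` of edge sets (`card_le_of_mixedCore_edges`) — the corrected form of
`card_le_of_bigBlock_edges` (which had the first leak set and `G4`).  The geometric chain of the
mixed single junction only has to build `r` and `φ` and check these hypotheses.
-/

namespace Summit.Ventures.PercRepro2

namespace BigBlock

open LocRows

open scoped Classical

variable {V : Type*} {E : Type*} [Fintype E] [DecidableEq E] {ends : E → Sym2 V}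
variable {ι κ : Type*} [Fintype ι] [DecidableEq ι] [Fintype κ] [DecidableEq κ]

omit [DecidableEq E] in
/-- **The corrected big-block principle, edge-set form** (`Leak'`, `G5`). -/
theorem card_le_of_mixedCore_edges (r : Pt ι κ → Config E)
    (hr : ∀ p q, ¬ Leak' p → ¬ Leak' q → r p = r q → p = q) (C : Finset (Config E))
    (hC : ∀ ζ, ζ ∈ C ↔ ∃ p, ¬ Leak' p ∧ r p = ζ) (Qs : Set (Config E))
    (hEv : ∀ p q, ¬ Leak' p → ¬ Leak' q → q ≤ p → r p ∈ Qs → r q ∈ Qs)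
    (hG : G5 {p | r p ∈ Qs}) (h : V)
    (φ : Set (Atom ι κ) → Set E) (hφ : Monotone φ)
    (hR : ∀ p, ¬ Leak' p → redEdges ends (r p) h = φ (ER p))
    (hB : ∀ p, ¬ Leak' p → blueEdges ends (r p) h = φ (EB p))
    {𝓔 : Set (Set E)} (h𝓔 : IsUpperSet 𝓔) :
    (C.filter fun ζ => ζ ∈ Qs ∧ redEdges ends ζ h ∈ 𝓔).card ≤
      (C.filter fun ζ => ζ ∈ Qs ∧ blueEdges ends ζ h ∈ 𝓔).card := by
  -- the class counts are counts over the non-leaking points of the cube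
  have e1 : (C.filter fun ζ => ζ ∈ Qs ∧ redEdges ends ζ h ∈ 𝓔) =
      (Finset.univ.filter fun p : Pt ι κ => r p ∈ Qs ∧ ¬ Leak' p ∧ ER p ∈ φ ⁻¹' 𝓔).image r := by
    ext ζ
    simp only [Finset.mem_filter, Finset.mem_image, Finset.mem_univ, true_and, Set.mem_preimage]
    constructor
    · rintro ⟨hζ, hQ, hE⟩
      obtain ⟨p, hp, rfl⟩ := (hC ζ).1 hζ
      refine ⟨p, ⟨hQ, hp, ?_⟩, rfl⟩
      rw [← hR p hp]; exact hE
    · rintro ⟨p, ⟨hQ, hp, hE⟩, rfl⟩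
      refine ⟨(hC _).2 ⟨p, hp, rfl⟩, hQ, ?_⟩
      rw [hR p hp]; exact hE
  have e2 : (C.filter fun ζ => ζ ∈ Qs ∧ blueEdges ends ζ h ∈ 𝓔) =
      (Finset.univ.filter fun p : Pt ι κ => r p ∈ Qs ∧ ¬ Leak' p ∧ EB p ∈ φ ⁻¹' 𝓔).image r := by
    ext ζ
    simp only [Finset.mem_filter, Finset.mem_image, Finset.mem_univ, true_and, Set.mem_preimage]
    constructor
    · rintro ⟨hζ, hQ, hE⟩
      obtain ⟨p, hp, rfl⟩ := (hC ζ).1 hζ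
      refine ⟨p, ⟨hQ, hp, ?_⟩, rfl⟩
      rw [← hB p hp]; exact hE
    · rintro ⟨p, ⟨hQ, hp, hE⟩, rfl⟩
      refine ⟨(hC _).2 ⟨p, hp, rfl⟩, hQ, ?_⟩
      rw [hB p hp]; exact hE
  -- `r` is injective on the non-leaking points
  have inj1 : Set.InjOn r
      ↑(Finset.univ.filter fun p : Pt ι κ => r p ∈ Qs ∧ ¬ Leak' p ∧ ER p ∈ φ ⁻¹' 𝓔) := by
    intro p hp q hq hpq
    simp only [Finset.coe_filter, Finset.mem_univ, true_and, Set.mem_setOf_eq] at hp hq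
    exact hr p q hp.2.1 hq.2.1 hpq
  have inj2 : Set.InjOn r
      ↑(Finset.univ.filter fun p : Pt ι κ => r p ∈ Qs ∧ ¬ Leak' p ∧ EB p ∈ φ ⁻¹' 𝓔) := by
    intro p hp q hq hpq
    simp only [Finset.coe_filter, Finset.mem_univ, true_and, Set.mem_setOf_eq] at hp hq
    exact hr p q hp.2.1 hq.2.1 hpq
  rw [e1, e2, Finset.card_image_of_injOn inj1, Finset.card_image_of_injOn inj2]
  -- the pulled-back up-set of atom sets
  have h𝓔' : IsUpperSet (φ ⁻¹' 𝓔) := by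
    intro S S' hSS' hS
    exact h𝓔 (hφ hSS') hS
  exact mixedCore_card_le' hEv hG h𝓔'

end BigBlock

end Summit.Ventures.PercRepro2
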